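import Summits.FinalStateConjecture.FinalStateConjecture.Theorems.EIHFluxBalanceInertialRecessionStubWeightedRatesSpinLipschitz
import Summits.FinalStateConjecture.FinalStateConjecture.Theorems.EIHFluxBalanceInertialRecessionStubWeightedRatesAxisDefect

/-!
# Route EIHFluxBalance — `InertialRecession`, line `sublinear-is-free-clean-window-charges`,
# stub `stub_weightedRates`: the spin-axis channel of `∂₀` of a painted summand

Helper file of the worker on `stub_weightedRates` (crux `stmt-FinalStateConjecture-10166`). The
landed structural estimate `…StubQuasiStationarityBound.norm_fderiv_summand_basisVector_zero_le`
bounds the lab-time derivative of one painted Kerr–Schild summand by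
`|M| G² ((B₁G + 2B₀) ν / d + B₁ G ‖ξ̇‖ / d²)`, where `ν` bounds the body rate `ω = Λ⁻¹Λ̇` modulo an
EXACT infinitesimal stabiliser element; for a spinning hole the stabiliser is one-dimensional, so
`ν` had to absorb the tilting rate of the spin axis with the crude kernel `M/d`
(`exists_stabiliser_correction`: `ν = 4G(‖Λ̇e₀‖ + [a ≠ 0]‖Λ̇e₃‖)`). Here the whole ROTATION part of
`ω` is removed for every `a` (`exists_rotation_correction`): it is an exact stabiliser of the
Schwarzschild form `g_{M,0}` (isotropy) and of the axial rotations of `g_{M,a}`, so its stabiliser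
DEFECT on `g_{M,a}` only involves `g_{M,a} − g_{M,0} = O(M|a|/d²)` (the landed spin-Lipschitz bounds
`kerrSpin_exists_lipschitz_bounds`) times the tilt coefficients `≤ ‖ω e₃‖`. The outcome
(`norm_fderiv_summand_basisVector_zero_le_columns`) is the REFINED structural estimate

  `‖D S(x)[e₀]‖ ≤ |M| G² ((B₁G + 2B₀)·4G‖Λ̇e₀‖ / d + B₁ G ‖ξ̇‖ / d²) + |M| Bₐ |a| G³ (4G + 8) ‖Λ̇e₃‖ / d²`,

in which the spin-axis rate enters with kernel `M|a|/d²` instead of `M/d`: against the weight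
`1 + d^{7/4}` it needs NO rate, only boundedness.
-/

set_option linter.dupNamespace false

noncomputable section

namespace Summit.FinalStateConjecture.FinalStateConjecture.Theorems.SublinearIsFree.WeightedRates

open scoped BigOperators Topology ContDiff
open Filter Set Function Literature.Geometry.Lorentzian
open Summit.FinalStateConjecture.FinalStateConjecture.Theorems
open Summit.FinalStateConjecture.FinalStateConjecture.Theorems.InertialRecession.Negative
open Summit.FinalStateConjecture.FinalStateConjecture.Theorems.SublinearIsFree.QuasiStationarity

/-! ### The tilt generators and their stabiliser defect on `g_{M,a}` -/

/-- Componentwise extensionality on `E4`. [folklore] -/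
private theorem ext4w {v w : E4} (h0 : v 0 = w 0) (h1 : v 1 = w 1) (h2 : v 2 = w 2)
    (h3 : v 3 = w 3) : v = w := by
  ext k
  fin_cases k <;> assumption

/-- The tilt generators `J23`, `J31` are bounded by `4` in operator norm (crudely: each column
`J e_μ ∈ {0, ±e_ν}` has norm `≤ 1`). [folklore] -/
theorem norm_tiltGen_apply_le (J : E4 →L[ℝ] E4) (hJ : J = J23 ∨ J = J31) (v : E4) :
    ‖J v‖ ≤ 4 * ‖v‖ := by
  have hcol : ∀ μ : Fin 4, ‖J (E4.basisVector μ)‖ ≤ 1 := by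
    intro μ
    rcases hJ with rfl | rfl
    · have h : J23 (E4.basisVector μ) = 0 ∨ J23 (E4.basisVector μ) = E4.basisVector 3 ∨
          J23 (E4.basisVector μ) = -E4.basisVector 2 := by
        fin_cases μ
        · left; refine ext4w ?_ ?_ ?_ ?_ <;>
            simp [(J23_apply _).1, (J23_apply _).2.1, (J23_apply _).2.2.1, (J23_apply _).2.2.2]
        · left; refine ext4w ?_ ?_ ?_ ?_ <;>
            simp [(J23_apply _).1, (J23_apply _).2.1, (J23_apply _).2.2.1, (J23_apply _).2.2.2]
        · right; left; refine ext4w ?_ ?_ ?_ ?_ <;>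
            simp [(J23_apply _).1, (J23_apply _).2.1, (J23_apply _).2.2.1, (J23_apply _).2.2.2]
        · right; right; refine ext4w ?_ ?_ ?_ ?_ <;>
            simp [(J23_apply _).1, (J23_apply _).2.1, (J23_apply _).2.2.1, (J23_apply _).2.2.2]
      rcases h with h | h | h <;> rw [h] <;> simp
    · have h : J31 (E4.basisVector μ) = 0 ∨ J31 (E4.basisVector μ) = E4.basisVector 1 ∨
          J31 (E4.basisVector μ) = -E4.basisVector 3 := by
        fin_cases μ
        · left; refine ext4w ?_ ?_ ?_ ?_ <;>
            simp [(J31_apply _).1, (J31_apply _).2.1, (J31_apply _).2.2.1, (J31_apply _).2.2.2]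
        · right; right; refine ext4w ?_ ?_ ?_ ?_ <;>
            simp [(J31_apply _).1, (J31_apply _).2.1, (J31_apply _).2.2.1, (J31_apply _).2.2.2]
        · left; refine ext4w ?_ ?_ ?_ ?_ <;>
            simp [(J31_apply _).1, (J31_apply _).2.1, (J31_apply _).2.2.1, (J31_apply _).2.2.2]
        · right; left; refine ext4w ?_ ?_ ?_ ?_ <;>
            simp [(J31_apply _).1, (J31_apply _).2.1, (J31_apply _).2.2.1, (J31_apply _).2.2.2]
      rcases h with h | h | h <;> rw [h] <;> simp
  have key := norm_apply_le_of_basisVector J (hcol 0) (hcol 1) (hcol 2) (hcol 3) v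
  linarith

-- operator-norm instance paths on form-valued maps are slow to unify
set_option synthInstance.maxHeartbeats 200000 in
/-- **The stabiliser defect of a tilt generator on the spinning form.** For `J ∈ {J23, J31}` (the
rotations tilting the spin axis `e₃`) and a point `p` with `‖p̲‖ ≥ max 1 (2|a|)`:
`|D(g_{M,a} − η)(p)[J p](v, w) + (g_{M,a} − η)(p)(J v, w) + (g_{M,a} − η)(p)(v, J w)|
 ≤ |M| Bₐ |a| (4‖p‖/‖p̲‖³ + 8/‖p̲‖²) ‖v‖ ‖w‖`: the same functional of the Schwarzschild form `g_{M,0}`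
vanishes identically (isotropy, `kerrBilin_zero_spin_invariant` + `stabiliser_generator_identity`),
and the difference is controlled by the spin-Lipschitz bounds `kerrSpin_exists_lipschitz_bounds`.
[cite: KerrSchild1965, §3] -/
theorem abs_tiltFunctional_le :
    ∃ Bₐ : ℝ, 0 ≤ Bₐ ∧ ∀ (M a : ℝ) (p : E4) (J : E4 →L[ℝ] E4), (J = J23 ∨ J = J31) →
      max 1 (2 * |a|) ≤ E4.spatialNorm p → ∀ v w : E4,
      |fderiv ℝ (fun y ↦ Kerr.bilin M a y - Minkowski.bilin) p (J p) v w +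
        (Kerr.bilin M a p - Minkowski.bilin) (J v) w +
        (Kerr.bilin M a p - Minkowski.bilin) v (J w)| ≤
        |M| * Bₐ * |a| * (4 * ‖p‖ / E4.spatialNorm p ^ 3 + 8 / E4.spatialNorm p ^ 2) *
          ‖v‖ * ‖w‖ := by
  obtain ⟨Bₐ, hBₐ, hB⟩ := kerrSpin_exists_lipschitz_bounds
  refine ⟨Bₐ, hBₐ, fun M a p J hJ hp v w ↦ ?_⟩
  set Ka : E4 → E4 →L[ℝ] E4 →L[ℝ] ℝ := fun y ↦ Kerr.bilin M a y - Minkowski.bilin with hKa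
  set K0 : E4 → E4 →L[ℝ] E4 →L[ℝ] ℝ := fun y ↦ Kerr.bilin M 0 y - Minkowski.bilin with hK0
  set σ := E4.spatialNorm p with hσ
  have hσ1 : 1 ≤ σ := (le_max_left _ _).trans hp
  have hσ0 : 0 < σ := one_pos.trans_le hσ1
  -- the Schwarzschild functional vanishes (isotropy)
  have hp0 : max 1 (2 * |(0 : ℝ)|) ≤ E4.spatialNorm p := by
    rw [abs_zero, mul_zero, max_eq_left zero_le_one]; exact hσ1
  have hdiff0 : DifferentiableAt ℝ K0 p := differentiableAt_ksPert_of_le hp0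
  have hJ' : J = J12 ∨ J = J23 ∨ J = J31 := Or.inr hJ
  obtain ⟨h1, h2, h3⟩ := rotGen_props J hJ'
  have hzero : fderiv ℝ K0 p (J p) v w + K0 p (J v) w + K0 p v (J w) = 0 :=
    stabiliser_generator_identity hdiff0
      (R := fun θ ↦ 1 + Real.sin θ • J + (1 - Real.cos θ) • J.comp J) (J := J)
      (rotCurve_zero_apply J) (hasDerivAt_rotCurve J)
      (fun θ v w ↦ kerrBilin_zero_spin_invariant
        (R := fun u ↦ (1 + Real.sin θ • J + (1 - Real.cos θ) • J.comp J) u)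
        (minkowski_rotCurve h1 h2 θ) (rotCurve_basisVector_zero h3 θ) M p v w)
      (fun θ v w ↦ minkowski_rotCurve h1 h2 θ v w) v w
  -- the difference `g_{M,a} − g_{M,0}` and its gradient
  obtain ⟨hval, hder⟩ := hB M a p hp
  have hJp : ‖J p‖ ≤ 4 * ‖p‖ := norm_tiltGen_apply_le J hJ p
  have hJv : ‖J v‖ ≤ 4 * ‖v‖ := norm_tiltGen_apply_le J hJ v
  have hJw : ‖J w‖ ≤ 4 * ‖w‖ := norm_tiltGen_apply_le J hJ w
  have hexpr : fderiv ℝ Ka p (J p) v w + Ka p (J v) w + Ka p v (J w) =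
      (fderiv ℝ Ka p (J p) - fderiv ℝ K0 p (J p)) v w + (Ka p - K0 p) (J v) w +
        (Ka p - K0 p) v (J w) := by
    simp only [sub_apply]
    linarith [hzero]
  rw [hexpr]
  have hD : ‖fderiv ℝ Ka p (J p) - fderiv ℝ K0 p (J p)‖ ≤ |M| * Bₐ * |a| / σ ^ 3 * (4 * ‖p‖) :=
    (hder (J p)).trans (mul_le_mul_of_nonneg_left hJp (by positivity))
  have hKd : ‖Ka p - K0 p‖ ≤ |M| * Bₐ * |a| / σ ^ 2 := hval
  have t1 : |(fderiv ℝ Ka p (J p) - fderiv ℝ K0 p (J p)) v w| ≤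
      |M| * Bₐ * |a| / σ ^ 3 * (4 * ‖p‖) * ‖v‖ * ‖w‖ := by
    refine (Real.norm_eq_abs _ ▸
      (fderiv ℝ Ka p (J p) - fderiv ℝ K0 p (J p)).le_opNorm₂ v w).trans ?_
    gcongr
  have t2 : |(Ka p - K0 p) (J v) w| ≤ |M| * Bₐ * |a| / σ ^ 2 * (4 * ‖v‖) * ‖w‖ := by
    refine (Real.norm_eq_abs _ ▸ (Ka p - K0 p).le_opNorm₂ (J v) w).trans ?_
    exact mul_le_mul (mul_le_mul hKd hJv (norm_nonneg _) (by positivity)) le_rfl (norm_nonneg _)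
      (by positivity)
  have t3 : |(Ka p - K0 p) v (J w)| ≤ |M| * Bₐ * |a| / σ ^ 2 * ‖v‖ * (4 * ‖w‖) := by
    refine (Real.norm_eq_abs _ ▸ (Ka p - K0 p).le_opNorm₂ v (J w)).trans ?_
    exact mul_le_mul (mul_le_mul_of_nonneg_right hKd (norm_nonneg _)) hJw (norm_nonneg _)
      (by positivity)
  have hsum := abs_add_three ((fderiv ℝ Ka p (J p) - fderiv ℝ K0 p (J p)) v w)
    ((Ka p - K0 p) (J v) w) ((Ka p - K0 p) v (J w))
  refine (hsum.trans (add_le_add (add_le_add t1 t2) t3)).trans (le_of_eq ?_)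
  rw [hσ]
  field_simp
  ring

/-! ### The rotation correction of the body-frame rate -/

-- operator-norm instance paths on form-valued maps are slow to unify
set_option synthInstance.maxHeartbeats 200000 in
/-- **The rotation correction.** At a point `p` with `‖p̲‖ ≥ max 1 (2|a|)`, the body-frame rate
`ω = Λ(t)⁻¹Λ̇(t)` of a Lorentz motion, corrected by its full ROTATION part
`ω_R = ω₂₁ J12 + ω₃₂ J23 + ω₁₃ J31`, satisfies (i) the stabiliser identity of `g_{M,a}` at `p` UP TO THE
DEFECT `|D(g−η)(p)[ω_R p](v,w) + (g−η)(p)(ω_R v, w) + (g−η)(p)(v, ω_R w)| ≤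
2(1 + 3γ)‖Λ̇e₃‖ · Q ‖v‖‖w‖`, where `Q = |M| Bₐ |a| (4‖p‖/‖p̲‖³ + 8/‖p̲‖²)` is the tilt defect of
`abs_tiltFunctional_le` (the axial rotation `J12` is an exact stabiliser, `kerrBilin_rotCLM`; the tilt
coefficients are entries of `ω e₃`), and (ii) `‖(ω − ω_R)u‖ ≤ 4(1 + 3γ)‖Λ̇e₀‖‖u‖`: the corrected
rate is the infinitesimal BOOST, controlled by the 4-velocity rate alone. [folklore] -/
theorem exists_rotation_correction :
    ∃ Bₐ : ℝ, 0 ≤ Bₐ ∧ ∀ (M a γ : ℝ) (Λ : ℝ → lorentzGroup) (t : ℝ) (L' : E4 →L[ℝ] E4),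
      HasDerivAt (fun s ↦ ((Λ s : E4 ≃L[ℝ] E4) : E4 →L[ℝ] E4)) L' t →
      |((Λ t : E4 ≃L[ℝ] E4) (E4.basisVector 0)) 0| ≤ γ → ∀ (p : E4),
      max 1 (2 * |a|) ≤ E4.spatialNorm p →
      ∃ SK : E4 →L[ℝ] E4,
        (∀ v w, |fderiv ℝ (fun y ↦ Kerr.bilin M a y - Minkowski.bilin) p (SK p) v w +
          (Kerr.bilin M a p - Minkowski.bilin) (SK v) w +
          (Kerr.bilin M a p - Minkowski.bilin) v (SK w)| ≤
          2 * (1 + 3 * γ) * ‖L' (E4.basisVector 3)‖ *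
            (|M| * Bₐ * |a| * (4 * ‖p‖ / E4.spatialNorm p ^ 3 + 8 / E4.spatialNorm p ^ 2)) *
            ‖v‖ * ‖w‖) ∧
        ∀ u, ‖((((Λ t : E4 ≃L[ℝ] E4).symm : E4 →L[ℝ] E4)).comp L' - SK) u‖ ≤
          4 * (1 + 3 * γ) * ‖L' (E4.basisVector 0)‖ * ‖u‖ := by
  obtain ⟨Bₐ, hBₐ, hB⟩ := abs_tiltFunctional_le
  refine ⟨Bₐ, hBₐ, fun M a γ Λ t L' hΛ' hγ p hp ↦ ?_⟩
  set A : E4 →L[ℝ] E4 := (((Λ t : E4 ≃L[ℝ] E4).symm : E4 →L[ℝ] E4)) with hAdef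
  set W : E4 →L[ℝ] E4 := A.comp L' with hW
  set D := fderiv ℝ (fun y ↦ Kerr.bilin M a y - Minkowski.bilin) p with hD
  set K := Kerr.bilin M a p - Minkowski.bilin with hK
  set Q := |M| * Bₐ * |a| * (4 * ‖p‖ / E4.spatialNorm p ^ 3 + 8 / E4.spatialNorm p ^ 2) with hQ
  have hσ1 : 1 ≤ E4.spatialNorm p := (le_max_left _ _).trans hp
  have hσ0 : 0 < E4.spatialNorm p := one_pos.trans_le hσ1
  have hQ0 : 0 ≤ Q := by positivity
  have hGA : ‖A‖ ≤ 1 + 3 * γ := (norm_lorentz_symm_le' (Λ t)).trans (by linarith)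
  have hG0 : 0 ≤ 1 + 3 * γ := (norm_nonneg A).trans hGA
  have hω : ∀ v w, Minkowski.bilin (W v) w + Minkowski.bilin v (W w) = 0 := fun v w ↦ by
    have h := minkowski_bodyRate_antisymm hΛ' v w
    simpa [hW, hAdef] using h
  have hWe : ∀ μ, ‖W (E4.basisVector μ)‖ ≤ (1 + 3 * γ) * ‖L' (E4.basisVector μ)‖ := fun μ ↦ by
    rw [hW, ContinuousLinearMap.comp_apply]
    exact (A.le_opNorm _).trans (mul_le_mul_of_nonneg_right hGA (norm_nonneg _))
  have hdiff : DifferentiableAt ℝ (fun y ↦ Kerr.bilin M a y - Minkowski.bilin) p :=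
    differentiableAt_ksPert_of_le hp
  refine ⟨(W (E4.basisVector 1) 2) • J12 + (W (E4.basisVector 2) 3) • J23 +
    (W (E4.basisVector 3) 1) • J31, fun v w ↦ ?_, fun u ↦ ?_⟩
  · -- the axial rotation is an exact stabiliser for every `a`
    have h12 : D (J12 p) v w + K (J12 v) w + K v (J12 w) = 0 :=
      stabiliser_generator_identity hdiff (R := rotCLM) (J := J12) rotCLM_zero
        hasDerivAt_rotCLM_zero (fun θ v w ↦ kerrBilin_rotCLM θ M a p v w)
        (fun θ v w ↦ minkowski_rotCLM θ v w) v w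
    have h23 := hB M a p J23 (Or.inl rfl) hp v w
    have h31 := hB M a p J31 (Or.inr rfl) hp v w
    rw [stabFunctional_smul_add, h12, mul_zero, zero_add]
    -- the tilt coefficients are entries of `ω e₃`
    obtain ⟨-, -, -, -, -, -, -, -, c23⟩ := so13_components W hω
    have hc2 : |W (E4.basisVector 2) 3| ≤ ‖W (E4.basisVector 3)‖ := by
      rw [c23, abs_neg]; exact abs_apply_le_norm _ 2
    have hc3 : |W (E4.basisVector 3) 1| ≤ ‖W (E4.basisVector 3)‖ := abs_apply_le_norm _ 1
    have hW3 : ‖W (E4.basisVector 3)‖ ≤ (1 + 3 * γ) * ‖L' (E4.basisVector 3)‖ := hWe 3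
    have hvw : 0 ≤ Q * ‖v‖ * ‖w‖ := by positivity
    calc |W (E4.basisVector 2) 3 * (D (J23 p) v w + K (J23 v) w + K v (J23 w)) +
          W (E4.basisVector 3) 1 * (D (J31 p) v w + K (J31 v) w + K v (J31 w))|
        ≤ |W (E4.basisVector 2) 3| * |D (J23 p) v w + K (J23 v) w + K v (J23 w)| +
          |W (E4.basisVector 3) 1| * |D (J31 p) v w + K (J31 v) w + K v (J31 w)| := by
          rw [← abs_mul, ← abs_mul]; exact abs_add_le _ _
      _ ≤ ‖W (E4.basisVector 3)‖ * (Q * ‖v‖ * ‖w‖) + ‖W (E4.basisVector 3)‖ * (Q * ‖v‖ * ‖w‖) :=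
          add_le_add (mul_le_mul hc2 h23 (abs_nonneg _) (norm_nonneg _))
            (mul_le_mul hc3 h31 (abs_nonneg _) (norm_nonneg _))
      _ ≤ (1 + 3 * γ) * ‖L' (E4.basisVector 3)‖ * (Q * ‖v‖ * ‖w‖) +
          (1 + 3 * γ) * ‖L' (E4.basisVector 3)‖ * (Q * ‖v‖ * ‖w‖) := by gcongr
      _ = 2 * (1 + 3 * γ) * ‖L' (E4.basisVector 3)‖ * Q * ‖v‖ * ‖w‖ := by ring
  · refine (norm_sub_rotStab_apply_le W hω u).trans ?_
    have h0 := hWe 0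
    have hu := norm_nonneg u
    nlinarith [mul_le_mul_of_nonneg_right h0 hu]

/-! ### The refined structural estimate in terms of the column rates -/

-- operator-norm instance paths on form-valued maps are slow to unify
set_option synthInstance.maxHeartbeats 200000 in
set_option maxHeartbeats 800000 in
/-- **The lab-time derivative of one painted summand is linear in the COLUMN rates, with kernels
`M/d` for the 4-velocity rate `‖Λ̇e₀‖`, `M|a|/d²` for the spin-axis rate `‖Λ̇e₃‖` and `M/d²` for
the drift `ξ̇`.** There are universal `B₀, B₁, Bₐ ≥ 0` such that for every Kerr parameter `(M, a)`,
every `C¹` Lorentz motion `Λ` (as operators, derivative `Λ̇(t)`) with Lorentz factor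
`|(Λ(t)e₀)⁰| ≤ γ`, every `C¹` centre `ξ`, and every slab point `x` (`x⁰ = t`) with
`d = ‖x̲ − ξ(t)‖ ≥ max 1 (2|a|)`, with `G = 1 + 3γ`:
`‖D S(x)[e₀]‖ ≤ |M| G² ((B₁G + 2B₀)(4G‖Λ̇e₀‖)/d + B₁G‖ξ̇‖/d²) + |M| Bₐ |a| G³ (8G + 16) ‖Λ̇e₃‖ / d²`
for the summand `S(y) = boostedKerrBilin (Λ(y⁰)) (y⁰, ξ(y⁰)) M a y − η`. Compared with
`norm_fderiv_summand_basisVector_zero_le` + `exists_stabiliser_correction`, the spin-axis rate has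
moved from the kernel `M/d` to the kernel `M|a|/d²` (rotation correction with defect,
`exists_rotation_correction`); nothing is claimed about the twist of the frame about the axis
(painting-rigidity loophole). [cite: KerrSchild1965, §3] -/
theorem norm_fderiv_summand_basisVector_zero_le_columns :
    ∃ B₀ B₁ Bₐ : ℝ, 0 ≤ B₀ ∧ 0 ≤ B₁ ∧ 0 ≤ Bₐ ∧ ∀ (M a γ : ℝ) (Λ : ℝ → lorentzGroup) (ξ : ℝ → E3)
      (t : ℝ) (x : E4),
      ContDiff ℝ 1 (fun s ↦ ((Λ s : E4 ≃L[ℝ] E4) : E4 →L[ℝ] E4)) → ContDiff ℝ 1 ξ →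
      |((Λ t : E4 ≃L[ℝ] E4) (E4.basisVector 0)) 0| ≤ γ → x 0 = t →
      max 1 (2 * |a|) ≤ ‖E4.spatial x - ξ t‖ →
      ‖fderiv ℝ (fun y : E4 ↦ boostedKerrBilin (Λ (y 0)) (E4.ofTimeSpace (y 0) (ξ (y 0))) M a y -
          Minkowski.bilin) x (E4.basisVector 0)‖ ≤
        |M| * (1 + 3 * γ) ^ 2 * ((B₁ * (1 + 3 * γ) + 2 * B₀) * (4 * (1 + 3 * γ) *
            ‖deriv (fun s ↦ ((Λ s : E4 ≃L[ℝ] E4) : E4 →L[ℝ] E4)) t (E4.basisVector 0)‖) /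
            ‖E4.spatial x - ξ t‖ +
          B₁ * (1 + 3 * γ) * ‖deriv ξ t‖ / ‖E4.spatial x - ξ t‖ ^ 2) +
        |M| * Bₐ * |a| * (1 + 3 * γ) ^ 3 * (8 * (1 + 3 * γ) + 16) *
          ‖deriv (fun s ↦ ((Λ s : E4 ≃L[ℝ] E4) : E4 →L[ℝ] E4)) t (E4.basisVector 3)‖ /
          ‖E4.spatial x - ξ t‖ ^ 2 := by
  obtain ⟨B₀, B₁, hB₀, hB₁, hmain⟩ := norm_fderiv_summand_basisVector_zero_le_defect
  obtain ⟨Bₐ, hBₐ, hrot⟩ := exists_rotation_correction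
  refine ⟨B₀, B₁, Bₐ, hB₀, hB₁, hBₐ, ?_⟩
  intro M a γ Λ ξ t x hΛ hξ hγ hx hd
  set A : E4 →L[ℝ] E4 := (((Λ t : E4 ≃L[ℝ] E4).symm : E4 →L[ℝ] E4)) with hAdef
  set L' : E4 →L[ℝ] E4 := deriv (fun s ↦ ((Λ s : E4 ≃L[ℝ] E4) : E4 →L[ℝ] E4)) t with hL'
  set d : ℝ := ‖E4.spatial x - ξ t‖ with hddef
  set p : E4 := A (E4.spaceEmbed (E4.spatial x - ξ t)) with hpdef
  set G : ℝ := 1 + 3 * γ with hG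
  set r₀ : ℝ := ‖L' (E4.basisVector 0)‖ with hr₀
  set r₃ : ℝ := ‖L' (E4.basisVector 3)‖ with hr₃
  have hγ1 : 1 ≤ γ := (one_le_abs_lorentz_apply_zero (Λ t)).trans hγ
  have hG1 : 1 ≤ G := by rw [hG]; linarith
  have hG0 : 0 ≤ G := zero_le_one.trans hG1
  have hAG : ‖A‖ ≤ G := (norm_lorentz_symm_le' (Λ t)).trans (by rw [hG]; linarith)
  have hd1 : 1 ≤ d := (le_max_left _ _).trans hd
  have hd0 : 0 < d := one_pos.trans_le hd1
  have hσ : d ≤ E4.spatialNorm p := le_spatialNorm_restPosition (Λ t) _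
  have hσ0 : 0 < E4.spatialNorm p := hd0.trans_le hσ
  have hσ' : max 1 (2 * |a|) ≤ E4.spatialNorm p := hd.trans hσ
  have hp : ‖p‖ ≤ G * d := by
    rw [hpdef]
    refine (A.le_opNorm _).trans ?_
    rw [norm_spaceEmbed]
    exact mul_le_mul_of_nonneg_right hAG (norm_nonneg _)
  have hΛ' : HasDerivAt (fun s ↦ ((Λ s : E4 ≃L[ℝ] E4) : E4 →L[ℝ] E4)) L' t :=
    (hΛ.differentiable one_ne_zero t).hasDerivAt
  obtain ⟨SK, hdef, hν⟩ := hrot M a γ Λ t L' hΛ' hγ p hσ'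
  set Q : ℝ := |M| * Bₐ * |a| * (4 * ‖p‖ / E4.spatialNorm p ^ 3 + 8 / E4.spatialNorm p ^ 2)
    with hQ
  have hQ0 : 0 ≤ Q := by positivity
  have hν0 : 0 ≤ 4 * G * r₀ := by positivity
  have hΔ0 : 0 ≤ 2 * G * r₃ * Q := by positivity
  have hdef' : ∀ v w, |fderiv ℝ (fun y ↦ Kerr.bilin M a y - Minkowski.bilin) p (SK p) v w +
      (Kerr.bilin M a p - Minkowski.bilin) (SK v) w +
      (Kerr.bilin M a p - Minkowski.bilin) v (SK w)| ≤ 2 * G * r₃ * Q * ‖v‖ * ‖w‖ :=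
    fun v w ↦ hdef v w
  have hν' : ∀ u, ‖(A.comp L' - SK) u‖ ≤ 4 * G * r₀ * ‖u‖ := fun u ↦ hν u
  have hbound := hmain M a γ Λ ξ t x SK (4 * G * r₀) (2 * G * r₃ * Q) hΛ hξ hγ hx hd hν0 hΔ0
    hdef' hν'
  refine hbound.trans (add_le_add le_rfl ?_)
  -- the defect against the kernel `M|a|/d²`
  have hQ' : Q ≤ |M| * Bₐ * |a| * ((4 * G + 8) / d ^ 2) := by
    rw [hQ]
    refine mul_le_mul_of_nonneg_left ?_ (by positivity)
    have h1 : 4 * ‖p‖ / E4.spatialNorm p ^ 3 ≤ 4 * (G * d) / d ^ 3 := by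
      refine div_le_div₀ (by positivity) (by linarith) (by positivity) ?_
      exact pow_le_pow_left₀ hd0.le hσ 3
    have h2 : 8 / E4.spatialNorm p ^ 2 ≤ 8 / d ^ 2 :=
      div_le_div_of_nonneg_left (by norm_num) (by positivity) (pow_le_pow_left₀ hd0.le hσ 2)
    have h3 : 4 * (G * d) / d ^ 3 + 8 / d ^ 2 = (4 * G + 8) / d ^ 2 := by
      field_simp
    linarith [h1, h2, h3.le, h3.ge]
  have hr₃0 : 0 ≤ r₃ := norm_nonneg _
  calc G ^ 2 * (2 * G * r₃ * Q)
      ≤ G ^ 2 * (2 * G * r₃ * (|M| * Bₐ * |a| * ((4 * G + 8) / d ^ 2))) := by gcongr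
    _ = |M| * Bₐ * |a| * G ^ 3 * (8 * G + 16) * r₃ / d ^ 2 := by
        field_simp
        ring

-- operator-norm instance paths on form-valued maps are slow to unify
set_option synthInstance.maxHeartbeats 200000 in
/-- **Registered sub-goal form** (worker carrier `painted_summand_columnRate_bound` of the crux item)
of `norm_fderiv_summand_basisVector_zero_le_columns`: the lab-time derivative of one painted summand is
linear in the column rates, kernels `M/d` (4-velocity rate), `M|a|/d²` (spin-axis rate), `M/d²`
(drift) — Kerr–Schild 1965, §3. [cite: KerrSchild1965, §3] -/
theorem painted_summand_columnRate_bound : open Literature.Geometry.Lorentzian in ∃ B₀ B₁ Bₐ : ℝ, 0 ≤ B₀ ∧ 0 ≤ B₁ ∧ 0 ≤ Bₐ ∧ ∀ (M a γ : ℝ) (Λ : ℝ → lorentzGroup) (ξ : ℝ → E3) (t : ℝ) (x : E4), ContDiff ℝ 1 (fun s ↦ ((Λ s : E4 ≃L[ℝ] E4) : E4 →L[ℝ] E4)) → ContDiff ℝ 1 ξ → |((Λ t : E4 ≃L[ℝ] E4) (E4.basisVector 0)) 0| ≤ γ → x 0 = t → max 1 (2 * |a|) ≤ ‖E4.spatial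 x - ξ t‖ → ‖fderiv ℝ (fun y : E4 ↦ boostedKerrBilin (Λ (y 0)) (E4.ofTimeSpace (y 0) (ξ (y 0))) M a y - Minkowski.bilin) x (E4.basisVector 0)‖ ≤ |M| * (1 + 3 * γ) ^ 2 * ((B₁ * (1 + 3 * γ) + 2 * B₀) * (4 * (1 + 3 * γ) * ‖deriv (fun s ↦ ((Λ s : E4 ≃L[ℝ] E4) : E4 →L[ℝ] E4)) t (E4.basisVector 0)‖) / ‖E4.spatial x - ξ t‖ + B₁ * (1 + 3 * γ) * ‖deriv ξ t‖ / ‖E4.spatial x - ξ t‖ ^ 2) + |M| * Bₐ * |a| * (1 + 3 * γ) ^ 3 * (8 * (1 + 3 * γ) + 16) * ‖deriv (fun s ↦ ((Λ s : E4 ≃L[ℝ] E4) : E4 →L[ℝ] E4)) t (E4.basisVector 3)‖ / ‖E4.spatial x - ξ t‖ ^ 2 :=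
  norm_fderiv_summand_basisVector_zero_le_columns

end Summit.FinalStateConjecture.FinalStateConjecture.Theorems.SublinearIsFree.WeightedRates

end
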